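import Summits.ResolutionOfSingularities.ResolutionOfSingularities.Theorems.FrobeniusLadderFInjectiveMacaulayficationPencilFedderCoeff
import Summits.ResolutionOfSingularities.ResolutionOfSingularities.Theorems.FrobeniusLadderFInjectiveMacaulayficationPencilCodeFedder
import Summits.ResolutionOfSingularities.ResolutionOfSingularities.Theorems.FrobeniusLadderFInjectiveMacaulayficationRsopMonomialPairs
import HarnessLib

/-!
# The per-point RECIPES of the direct Fedder argument: from the shape of the pencil pair `(u, v)` on a regular system of parameters to the six inputs of
# ✓ `PencilStalkOverPoint.fullCl_stalk_of_pair_germ_over` (regular pair + FULL of both pencil charts at every prime over `𝔪`)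
# (BED Ω₁ GLOBAL PATCH, F6 v2 §2 «codes 1–5»; crux `FInjectiveMacaulayfication` stmt-ResolutionOfSingularities-15315, chain w45a; seat res-L1-w45a-stub-3 g15)

[OURS · L1 W4.5a] Support file (`--supports stmt-ResolutionOfSingularities-15315 --as helper`); theorems only; GENERIC commutative algebra; no named fact; NOT a statement of any
manuscript; nothing of the crux is proved. AI-written (AI review is weaker than expert review).

`(B, 𝔪)` regular local of characteristic `p` with algebraically closed residue field, `s` an r.s.o.p. (list; monomials `∏ s[i]^(e i)` by position, exponents `ℕ → ℕ`).
* §1 bookkeeping: `monomial_mem_maximalIdeal`, `monomial_ne_zero`, `unit_mul_monomial_not_mem_span_getElem`, `binomial_not_mem_span_getElem_of_disjoint`.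
* §2 ★★ `recipe_two_monomials` — `u = ε·mono a`, `v = ε′·mono m`, disjoint supports, both non-constant, and ONE of: `m ≤ 1` (tag 1) · `a ≤ 1` (tag 2) · `a, m ≤ 2`, `p ≠ 2` (tag 3)
  ⇒ `u, v` non-zero-divisors, `u ∣ rv → u ∣ r`, `v ∣ ru → v ∣ r`, and BOTH pencil charts `B[X]/(uX − v)`, `B[X]/(vX − u)` are `FullCl p` at every prime over `𝔪`. Covers the one-sided
  orbits, the T1 orbits at points with `w ≠ 0`, and — with `w̄` a member of `s` absorbed into `m` — the T1 orbits at points with `w = 0`.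
* §3 ★★ `recipe_deep` — `u = ε·mono a`, `v = ε′·mono m·(ε₃·mono b − ε₄·mono c)` (`a ⊥ m`, `b ⊥ c`, `a, b, c ≠ 0`) and ONE of: tag 4 (`a ≤ 1` and each of `m + b`, `m + c` has a
  letter off `supp a`) · tag 5 (`m + b ≤ 1` and a letter `i₀` with `a i₀ ≠ 0 = b i₀`) ⇒ the same six conclusions.
All Fedder facts are instances of ✓ `PencilCodeFedder.sumMonomials_add_pow_not_mem` / `sumMonomials_add_add_pow_not_mem`, ✓ `PencilFedderTrinomial.unit_mul_monomial_pow_not_mem_frobeniusPower`,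
✓ `PencilFedderCoeff.fullCl_localization_pencilQuot_code3`; FULL then by ✓ `PencilFedderRegularBasePole.fullCl_localization_pencilQuot_of_over'`; the regular pair by ✓ `RsopMonomialPairs`.
[cite: Fedder1983, Prop. 1.7, Thm. 1.12; Matsumura1987, Thm. 17.4]
-/

set_option linter.dupNamespace false

noncomputable section

namespace Summit.ResolutionOfSingularities.ResolutionOfSingularities.Theorems.FInjectiveMacaulayfication.PencilPointRecipes

open IsLocalRing Polynomial Literature.RingTheory.TightClosure Literature.AlgebraicGeometry.Resolution
open Summit.ResolutionOfSingularities.ResolutionOfSingularities.Theorems.FInjectiveMacaulayfication SliceableCentre SopFrobeniusPower PencilFedderTrinomial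
  PencilCodeFedder PencilFedderRegularBasePole PencilFedderCoeff RsopMonomialPairs

variable (p : ℕ) [Fact p.Prime] {B : Type} [CommRing B] [IsRegularLocalRing B]
  (s : List B) (hspan : Ideal.ofList s = maximalIdeal B) (hlen : (s.length : WithBot ℕ∞) = ringKrullDim B)

/-! ## §1 Bookkeeping -/

include hspan in
omit [Fact p.Prime] in
/-- A monomial with a positive exponent lies in `𝔪`. [plumbing] -/
theorem monomial_mem_maximalIdeal (e : ℕ → ℕ) (i : Fin s.length) (hi : e i ≠ 0) :
    (∏ j : Fin s.length, s[j] ^ e j) ∈ maximalIdeal B := by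
  rw [← Finset.mul_prod_erase Finset.univ (fun j : Fin s.length => s[j] ^ e j) (Finset.mem_univ i)]
  refine Ideal.mul_mem_right _ _ (Ideal.pow_mem_of_mem _ ?_ _ (Nat.pos_of_ne_zero hi))
  rw [← hspan]
  exact Ideal.subset_span (List.getElem_mem i.2)

include hspan hlen in
omit [Fact p.Prime] in
/-- `ε·∏ s[j]^(e j) ≠ 0` for a unit `ε`. [plumbing] -/
theorem unit_mul_monomial_ne_zero (e : ℕ → ℕ) (ε : B) (hε : IsUnit ε) : ε * (∏ j : Fin s.length, s[j] ^ e j) ≠ 0 := by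
  haveI : IsDomain B := isDomain_of_isRegularLocalRing B
  exact mul_ne_zero hε.ne_zero (Finset.prod_ne_zero_iff.mpr fun j _ => pow_ne_zero _ (getElem_ne_zero s hspan hlen j))

include hspan hlen in
omit [Fact p.Prime] in
/-- `ε·∏ s[j]^(m j) ∉ (s[i])` when `m i = 0`. [plumbing] -/
theorem unit_mul_monomial_not_mem_span_getElem (m : ℕ → ℕ) (ε : B) (hε : IsUnit ε) (i : Fin s.length) (hi : m i = 0) :
    ε * (∏ j : Fin s.length, s[j] ^ m j) ∉ (Ideal.span {s[i]} : Ideal B) := fun h =>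
  monomial_not_mem_span_getElem s hspan hlen m i hi ((Submodule.smul_mem_iff_of_isUnit _ hε).mp h)

include hspan hlen in
omit [Fact p.Prime] in
/-- `ε₃·mono b − ε₄·mono c ∉ (s[i])` for EVERY `i`, when `b ⊥ c` and `b ≠ 0`. [folklore] -/
theorem binomial_not_mem_span_getElem_of_disjoint (b c : ℕ → ℕ) (hbc : ∀ i : ℕ, b i = 0 ∨ c i = 0) (hb : ∃ j : Fin s.length, b j ≠ 0)
    (ε₃ ε₄ : B) (hε₃ : IsUnit ε₃) (hε₄ : IsUnit ε₄) (i : Fin s.length) :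
    ε₃ * (∏ l : Fin s.length, s[l] ^ b l) - ε₄ * (∏ l : Fin s.length, s[l] ^ c l) ∉ (Ideal.span {s[i]} : Ideal B) := by
  obtain ⟨j, hj⟩ := hb
  have hne : ∃ j : Fin s.length, b j ≠ c j := ⟨j, by rcases hbc j with h | h <;> omega⟩
  by_cases hbi : b i = 0
  · by_cases hci : c i = 0
    · exact binomial_not_mem_span_getElem s hspan hlen b c i hbi hci hne ε₃ ε₄ hε₃ hε₄
    · -- `mono c ∈ (s[i])`, so membership would put `ε₃ mono b` in `(s[i])`
      intro h
      have hc : ε₄ * (∏ l : Fin s.length, s[l] ^ c l) ∈ (Ideal.span {s[i]} : Ideal B) := by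
        refine Ideal.mul_mem_left _ _ ?_
        rw [← Finset.mul_prod_erase Finset.univ (fun l : Fin s.length => s[l] ^ c l) (Finset.mem_univ i)]
        exact Ideal.mul_mem_right _ _ (Ideal.pow_mem_of_mem _ (Ideal.mem_span_singleton_self _) _ (Nat.pos_of_ne_zero hci))
      have : ε₃ * (∏ l : Fin s.length, s[l] ^ b l) ∈ (Ideal.span {s[i]} : Ideal B) := by
        have := Submodule.add_mem _ h hc
        rwa [sub_add_cancel] at this
      exact unit_mul_monomial_not_mem_span_getElem s hspan hlen b ε₃ hε₃ i hbi this
  · have hci : c i = 0 := (hbc i).resolve_left hbi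
    intro h
    have hb' : ε₃ * (∏ l : Fin s.length, s[l] ^ b l) ∈ (Ideal.span {s[i]} : Ideal B) := by
      refine Ideal.mul_mem_left _ _ ?_
      rw [← Finset.mul_prod_erase Finset.univ (fun l : Fin s.length => s[l] ^ b l) (Finset.mem_univ i)]
      exact Ideal.mul_mem_right _ _ (Ideal.pow_mem_of_mem _ (Ideal.mem_span_singleton_self _) _ (Nat.pos_of_ne_zero hbi))
    have : ε₄ * (∏ l : Fin s.length, s[l] ^ c l) ∈ (Ideal.span {s[i]} : Ideal B) := by
      have := Submodule.sub_mem _ hb' h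
      rwa [sub_sub_cancel] at this
    exact unit_mul_monomial_not_mem_span_getElem s hspan hlen c ε₄ hε₄ i hci this

/-! ## §2 ★★ Two monomials (tags 1, 2, 3) -/

variable [CharP B p] [IsAlgClosed (ResidueField B)]

include hspan hlen in
/-- ★★ **RECIPE FOR TWO MONOMIALS** (one-sided orbits; T1 orbits at `w ≠ 0`; T1 orbits at `w = 0` with `w̄ ∈ s` absorbed into `m`). See the module docstring.
[OURS · F6 v2 §2 codes 1/2/3; cite: Fedder1983, Thm. 1.12; Matsumura1987, Thm. 17.4] -/
theorem recipe_two_monomials (a m : ℕ → ℕ) (hdisj : ∀ i : ℕ, a i = 0 ∨ m i = 0) (ha : ∃ i : Fin s.length, a i ≠ 0) (hm : ∃ i : Fin s.length, m i ≠ 0)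
    (ε ε' : B) (hε : IsUnit ε) (hε' : IsUnit ε') (u v : B)
    (hu : u = ε * ∏ i : Fin s.length, s[i] ^ a i) (hv : v = ε' * ∏ i : Fin s.length, s[i] ^ m i)
    (hcode : (∀ i, m i ≤ 1) ∨ (∀ i, a i ≤ 1) ∨ ((∀ i, a i ≤ 2) ∧ (∀ i, m i ≤ 2) ∧ p ≠ 2)) :
    u ∈ nonZeroDivisors B ∧ (∀ r : B, u ∣ r * v → u ∣ r) ∧ v ∈ nonZeroDivisors B ∧ (∀ r : B, v ∣ r * u → v ∣ r) ∧
      (∀ (Q : Ideal (B[X] ⧸ Ideal.span {C u * X - C v})) [Q.IsPrime],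
        (Q.comap (Ideal.Quotient.mk (Ideal.span {C u * X - C v}))).comap (C : B →+* B[X]) = maximalIdeal B → FullCl p (Localization.AtPrime Q)) ∧
      (∀ (Q : Ideal (B[X] ⧸ Ideal.span {C v * X - C u})) [Q.IsPrime],
        (Q.comap (Ideal.Quotient.mk (Ideal.span {C v * X - C u}))).comap (C : B →+* B[X]) = maximalIdeal B → FullCl p (Localization.AtPrime Q)) := by
  haveI : IsDomain B := isDomain_of_isRegularLocalRing B
  obtain ⟨i₁, hi₁⟩ := ha
  obtain ⟨i₂, hi₂⟩ := hm
  have hm₁ : m i₁ = 0 := (hdisj i₁).resolve_left hi₁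
  have ha₂ : a i₂ = 0 := by rcases hdisj i₂ with h | h; exacts [h, absurd h hi₂]
  have hv0 : v ≠ 0 := by rw [hv]; exact unit_mul_monomial_ne_zero s hspan hlen m ε' hε'
  have hvout : ∀ i : Fin s.length, a i ≠ 0 → v ∉ (Ideal.span {s[i]} : Ideal B) := fun i hi => by
    rw [hv]; exact unit_mul_monomial_not_mem_span_getElem s hspan hlen m ε' hε' i ((hdisj i).resolve_left hi)
  obtain ⟨hu0, huv, hvu, hdomW, hdomU⟩ := pencil_pair_package s hspan hlen a ε hε u v hu hv0 hvout
  have hum : u ∈ maximalIdeal B := by rw [hu]; exact Ideal.mul_mem_left _ _ (monomial_mem_maximalIdeal s hspan a i₁ hi₁)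
  have hvm : v ∈ maximalIdeal B := by rw [hv]; exact Ideal.mul_mem_left _ _ (monomial_mem_maximalIdeal s hspan m i₂ hi₂)
  -- the four Fedder facts
  have Fu : (∀ i, a i ≤ 1) → u ^ (p - 1) ∉ frobeniusPower p (maximalIdeal B) := fun h =>
    unit_mul_monomial_pow_not_mem_frobeniusPower p s hspan hlen u ε a h hε hu
  have Fv : (∀ i, m i ≤ 1) → v ^ (p - 1) ∉ frobeniusPower p (maximalIdeal B) := fun h =>
    unit_mul_monomial_pow_not_mem_frobeniusPower p s hspan hlen v ε' m h hε' hv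
  have FW : (∀ i, m i ≤ 1) → ∀ w₀ : B, (u * w₀ - v) ^ (p - 1) ∉ frobeniusPower p (maximalIdeal B) := fun h w₀ => by
    have key := sumMonomials_add_pow_not_mem p s hspan hlen m h (-ε') hε'.neg (-v) (by rw [hv]; ring) [(ε * w₀, a)]
      (fun q hq => by rw [List.mem_singleton] at hq; subst hq; exact ⟨i₁, hi₁, hm₁⟩) (u * w₀)
      (by rw [hu, List.map_singleton, List.sum_singleton]; ring)
    rwa [← sub_eq_add_neg] at key
  have FU : (∀ i, a i ≤ 1) → ∀ w₁ : B, (v * w₁ - u) ^ (p - 1) ∉ frobeniusPower p (maximalIdeal B) := fun h w₁ => by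
    have key := sumMonomials_add_pow_not_mem p s hspan hlen a h (-ε) hε.neg (-u) (by rw [hu]; ring) [(ε' * w₁, m)]
      (fun q hq => by rw [List.mem_singleton] at hq; subst hq; exact ⟨i₂, hi₂, ha₂⟩) (v * w₁)
      (by rw [hv, List.map_singleton, List.sum_singleton]; ring)
    rwa [← sub_eq_add_neg] at key
  refine ⟨mem_nonZeroDivisors_of_ne_zero hu0, huv, mem_nonZeroDivisors_of_ne_zero hv0, hvu, ?_⟩
  rcases hcode with h1 | h2 | ⟨h3a, h3m, hp2⟩
  · exact ⟨fun Q _ hQ => fullCl_localization_pencilQuot_of_over' p u v hum hvm (fun w₀ _ => Or.inl (FW h1 w₀)) (Or.inl (Fv h1)) hdomW Q hQ,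
      fun Q _ hQ => fullCl_localization_pencilQuot_of_over' p v u hvm hum (fun _ _ => Or.inr (Fv h1)) (Or.inr (Fv h1)) hdomU Q hQ⟩
  · exact ⟨fun Q _ hQ => fullCl_localization_pencilQuot_of_over' p u v hum hvm (fun _ _ => Or.inr (Fu h2)) (Or.inr (Fu h2)) hdomW Q hQ,
      fun Q _ hQ => fullCl_localization_pencilQuot_of_over' p v u hvm hum (fun w₁ _ => Or.inl (FU h2 w₁)) (Or.inl (Fu h2)) hdomU Q hQ⟩
  · have ham : ∀ i, a i + m i ≤ 2 := fun i => by
      have := h3a i; have := h3m i; rcases hdisj i with h | h <;> omega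
    have hma : ∀ i, m i + a i ≤ 2 := fun i => by rw [add_comm]; exact ham i
    exact ⟨fun Q _ hQ => fullCl_localization_pencilQuot_code3 p hp2 s hspan hlen a m ham i₁ hi₁ hm₁ ε ε' hε hε' u v hu hv hvm hdomW Q hQ,
      fun Q _ hQ => fullCl_localization_pencilQuot_code3 p hp2 s hspan hlen m a hma i₂ hi₂ ha₂ ε' ε hε' hε v u hv hu hum hdomU Q hQ⟩

/-! ## §3 ★★ The deep orbits (tags 4, 5) -/

set_option maxHeartbeats 800000 in
include hspan hlen in
/-- ★★ **RECIPE FOR THE DEEP ORBITS** (`r|Z ≠ 0 ≠ s|Z`). See the module docstring. [OURS · F6 v2 §2 codes 4/5; cite: Fedder1983, Thm. 1.12; Matsumura1987, Thm. 17.4] -/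
theorem recipe_deep (a m b c : ℕ → ℕ) (ham : ∀ i : ℕ, a i = 0 ∨ m i = 0) (hbc : ∀ i : ℕ, b i = 0 ∨ c i = 0)
    (ha : ∃ i : Fin s.length, a i ≠ 0) (hb : ∃ i : Fin s.length, b i ≠ 0) (hc : ∃ i : Fin s.length, c i ≠ 0)
    (ε ε' ε₃ ε₄ : B) (hε : IsUnit ε) (hε' : IsUnit ε') (hε₃ : IsUnit ε₃) (hε₄ : IsUnit ε₄) (u v : B)
    (hu : u = ε * ∏ i : Fin s.length, s[i] ^ a i)
    (hv : v = ε' * (∏ i : Fin s.length, s[i] ^ m i) * (ε₃ * (∏ i : Fin s.length, s[i] ^ b i) - ε₄ * (∏ i : Fin s.length, s[i] ^ c i)))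
    (hcode : ((∀ i, a i ≤ 1) ∧ (∃ i : Fin s.length, m i + b i ≠ 0 ∧ a i = 0) ∧ (∃ i : Fin s.length, m i + c i ≠ 0 ∧ a i = 0)) ∨
      ((∀ i, m i + b i ≤ 1) ∧ (∃ i₀ : Fin s.length, a i₀ ≠ 0 ∧ b i₀ = 0))) :
    u ∈ nonZeroDivisors B ∧ (∀ r : B, u ∣ r * v → u ∣ r) ∧ v ∈ nonZeroDivisors B ∧ (∀ r : B, v ∣ r * u → v ∣ r) ∧
      (∀ (Q : Ideal (B[X] ⧸ Ideal.span {C u * X - C v})) [Q.IsPrime],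
        (Q.comap (Ideal.Quotient.mk (Ideal.span {C u * X - C v}))).comap (C : B →+* B[X]) = maximalIdeal B → FullCl p (Localization.AtPrime Q)) ∧
      (∀ (Q : Ideal (B[X] ⧸ Ideal.span {C v * X - C u})) [Q.IsPrime],
        (Q.comap (Ideal.Quotient.mk (Ideal.span {C v * X - C u}))).comap (C : B →+* B[X]) = maximalIdeal B → FullCl p (Localization.AtPrime Q)) := by
  haveI : IsDomain B := isDomain_of_isRegularLocalRing B
  obtain ⟨i₁, hi₁⟩ := ha
  obtain ⟨i₃, hi₃⟩ := hc
  have hb₃ : b i₃ = 0 := by rcases hbc i₃ with h | h; exacts [h, absurd h hi₃]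
  -- `v` as a binomial in the monomials `m + b`, `m + c`
  have hv' : v = (ε' * ε₃) * (∏ i : Fin s.length, s[i] ^ (m i + b i)) - (ε' * ε₄) * (∏ i : Fin s.length, s[i] ^ (m i + c i)) := by
    rw [hv, ← prod_pow_mul_prod_pow s m b, ← prod_pow_mul_prod_pow s m c]; ring
  have hχ0 : ε₃ * (∏ i : Fin s.length, s[i] ^ b i) - ε₄ * (∏ i : Fin s.length, s[i] ^ c i) ≠ 0 := fun h0 => by
    have := binomial_not_mem_span_getElem_of_disjoint s hspan hlen b c hbc hb ε₃ ε₄ hε₃ hε₄ i₁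
    rw [h0] at this
    exact this (Submodule.zero_mem _)
  have hv0 : v ≠ 0 := by rw [hv]; exact mul_ne_zero (unit_mul_monomial_ne_zero s hspan hlen m ε' hε') hχ0
  have hvout : ∀ i : Fin s.length, a i ≠ 0 → v ∉ (Ideal.span {s[i]} : Ideal B) := fun i hi hmem => by
    haveI := isPrime_span_getElem s hspan hlen i
    rw [hv] at hmem
    rcases Ideal.IsPrime.mem_or_mem ‹_› hmem with h | h
    · exact unit_mul_monomial_not_mem_span_getElem s hspan hlen m ε' hε' i ((ham i).resolve_left hi) h
    · exact binomial_not_mem_span_getElem_of_disjoint s hspan hlen b c hbc hb ε₃ ε₄ hε₃ hε₄ i h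
  obtain ⟨hu0, huv, hvu, hdomW, hdomU⟩ := pencil_pair_package s hspan hlen a ε hε u v hu hv0 hvout
  have hum : u ∈ maximalIdeal B := by rw [hu]; exact Ideal.mul_mem_left _ _ (monomial_mem_maximalIdeal s hspan a i₁ hi₁)
  have hvm : v ∈ maximalIdeal B := by
    rw [hv']
    obtain ⟨i₂, hi₂⟩ := hb
    refine Submodule.sub_mem _ (Ideal.mul_mem_left _ _ (monomial_mem_maximalIdeal s hspan (fun i => m i + b i) i₂ (by omega)))
      (Ideal.mul_mem_left _ _ (monomial_mem_maximalIdeal s hspan (fun i => m i + c i) i₃ (by omega)))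
  have hlt : ∃ i' : Fin s.length, m i' + b i' < m i' + c i' := ⟨i₃, by have := Nat.pos_of_ne_zero hi₃; omega⟩
  -- the Fedder facts
  have Fu : (∀ i, a i ≤ 1) → u ^ (p - 1) ∉ frobeniusPower p (maximalIdeal B) := fun h =>
    unit_mul_monomial_pow_not_mem_frobeniusPower p s hspan hlen u ε a h hε hu
  have Fv : (∀ i, m i + b i ≤ 1) → v ^ (p - 1) ∉ frobeniusPower p (maximalIdeal B) := fun h => by
    have key := sumMonomials_add_add_pow_not_mem p s hspan hlen (fun i => m i + b i) h (ε' * ε₃) (hε'.mul hε₃) _ rfl []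
      (fun q hq => by simp at hq) 0 (by rw [List.map_nil, List.sum_nil]) (fun i => m i + c i) (-(ε' * ε₄)) _ rfl hlt
    have : v = 0 + (ε' * ε₃) * (∏ i : Fin s.length, s[i] ^ (m i + b i)) + -(ε' * ε₄) * (∏ i : Fin s.length, s[i] ^ (m i + c i)) := by
      rw [hv']; ring
    rw [this]
    exact key
  have FW : (∀ i, m i + b i ≤ 1) → (∃ i₀ : Fin s.length, a i₀ ≠ 0 ∧ b i₀ = 0) → ∀ w₀ : B, (u * w₀ - v) ^ (p - 1) ∉ frobeniusPower p (maximalIdeal B) := by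
    intro h ⟨i₀, ha₀, hb₀⟩ w₀
    have hm₀ : m i₀ = 0 := (ham i₀).resolve_left ha₀
    have key := sumMonomials_add_add_pow_not_mem p s hspan hlen (fun i => m i + b i) h (-(ε' * ε₃)) (hε'.mul hε₃).neg _ rfl [(ε * w₀, a)]
      (fun q hq => by rw [List.mem_singleton] at hq; subst hq; exact ⟨i₀, ha₀, by omega⟩) (u * w₀)
      (by rw [hu, List.map_singleton, List.sum_singleton]; ring) (fun i => m i + c i) (ε' * ε₄) _ rfl hlt
    have : u * w₀ - v = u * w₀ + -(ε' * ε₃) * (∏ i : Fin s.length, s[i] ^ (m i + b i)) + (ε' * ε₄) * (∏ i : Fin s.length, s[i] ^ (m i + c i)) := by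
      rw [hv']; ring
    rwa [this]
  have FU5 : (∀ i, m i + b i ≤ 1) → (∃ i₀ : Fin s.length, a i₀ ≠ 0 ∧ b i₀ = 0) → ∀ w₁ : B, IsUnit w₁ →
      (v * w₁ - u) ^ (p - 1) ∉ frobeniusPower p (maximalIdeal B) := by
    intro h ⟨i₀, ha₀, hb₀⟩ w₁ hw₁
    have hm₀ : m i₀ = 0 := (ham i₀).resolve_left ha₀
    have key := sumMonomials_add_add_pow_not_mem p s hspan hlen (fun i => m i + b i) h (w₁ * (ε' * ε₃)) (hw₁.mul (hε'.mul hε₃)) _ rfl [(-ε, a)]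
      (fun q hq => by rw [List.mem_singleton] at hq; subst hq; exact ⟨i₀, ha₀, by omega⟩) (-u)
      (by rw [hu, List.map_singleton, List.sum_singleton]; ring) (fun i => m i + c i) (-(w₁ * (ε' * ε₄))) _ rfl hlt
    have : v * w₁ - u = -u + (w₁ * (ε' * ε₃)) * (∏ i : Fin s.length, s[i] ^ (m i + b i)) + -(w₁ * (ε' * ε₄)) * (∏ i : Fin s.length, s[i] ^ (m i + c i)) := by
      rw [hv']; ring
    rwa [this]
  have FU4 : (∀ i, a i ≤ 1) → (∃ i : Fin s.length, m i + b i ≠ 0 ∧ a i = 0) → (∃ i : Fin s.length, m i + c i ≠ 0 ∧ a i = 0) → ∀ w₁ : B,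
      (v * w₁ - u) ^ (p - 1) ∉ frobeniusPower p (maximalIdeal B) := by
    intro h hsb hsc w₁
    have key := sumMonomials_add_pow_not_mem p s hspan hlen a h (-ε) hε.neg (-u) (by rw [hu]; ring)
      [(w₁ * (ε' * ε₃), fun i => m i + b i), (-(w₁ * (ε' * ε₄)), fun i => m i + c i)]
      (fun q hq => by
        rw [List.mem_cons, List.mem_singleton] at hq
        rcases hq with rfl | rfl
        · exact hsb
        · exact hsc) (v * w₁)
      (by rw [hv', List.map_cons, List.map_singleton, List.sum_cons, List.sum_singleton]; ring)
    rwa [← sub_eq_add_neg] at key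
  refine ⟨mem_nonZeroDivisors_of_ne_zero hu0, huv, mem_nonZeroDivisors_of_ne_zero hv0, hvu, ?_⟩
  rcases hcode with ⟨h4, hsb, hsc⟩ | ⟨h5, hwit⟩
  · exact ⟨fun Q _ hQ => fullCl_localization_pencilQuot_of_over' p u v hum hvm (fun _ _ => Or.inr (Fu h4)) (Or.inr (Fu h4)) hdomW Q hQ,
      fun Q _ hQ => fullCl_localization_pencilQuot_of_over' p v u hvm hum (fun w₁ _ => Or.inl (FU4 h4 hsb hsc w₁)) (Or.inl (Fu h4)) hdomU Q hQ⟩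
  · exact ⟨fun Q _ hQ => fullCl_localization_pencilQuot_of_over' p u v hum hvm (fun w₀ _ => Or.inl (FW h5 hwit w₀)) (Or.inl (Fv h5)) hdomW Q hQ,
      fun Q _ hQ => fullCl_localization_pencilQuot_of_over' p v u hvm hum (fun w₁ hw₁ => Or.inl (FU5 h5 hwit w₁ hw₁)) (Or.inr (Fv h5)) hdomU Q hQ⟩

end Summit.ResolutionOfSingularities.ResolutionOfSingularities.Theorems.FInjectiveMacaulayfication.PencilPointRecipes

end
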